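import Summits.QuantumFields.YangMills.Theorems.BalabanUVNodesN15TwoGridDressedLaplacianIdentity
import HarnessLib

/-!
# N15 (NE2) — PROGRAMME Λ, part Λ-B: ★★★ THE η-DEFECT OF THE DRESSED COVARIANT-LAPLACIAN ENTRY `𝔇((Δ′ − V₁′)X′, (Δ − V̄₁)X̄)` OF BAŁABAN's LANDAU-GAUGE PAIR `(Δ′_a⁻¹, Δ_a⁻¹)`
# UNDER THE (3.35) PAIR ALONE, SUP-BLOCK CURRENCY, HYPOTHESIS-FREE (Λ-A's five-letter majorant fired on the letters of record)

WHO ∕ WHEN.  Cell `pub-ymgap`, seat `pub-ymgap-dag-n15-a` (KNIT-BY-NAME seat of Track-A DAG node N15 = NE2, g27); `--kind proof --supports stmt-QuantumFields-27366 --as helper` (K3⁸;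
count-neutral).  THEOREMS ONLY (0 `def`).  Over Λ-A `…TwoGridDressedLaplacianIdentity` (★★ `hasMaj_idef_covLap_of_letters`), K-J `…TwoGridDressedJetNoFitFullG` (★★
`hasMaj_projO_idef_bgPair_gOp`, entry 0 of the dressed jet), part 47 (`hasMaj_landauRe`), part 53 (`hasMaj_landauDefect_family`), N-IIs (`hasMaj_idef_qvAdjRe_qvRe_rough`), part 42
(`ineq110_114_pair`, `hasMaj_gOp_of_ineq`, `hasMaj_grad_of_ineq`), II-B (`hasMaj_bgPair_comp`), n15-b (`abs_blockAvg_le`) BY NAME; nothing in the tree is modified.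

WHAT.  §31 ★★★ **`hasMaj_idef_covLap_gOp (hLodd : Odd L) (hL3 : 3 ≤ L) (ha : 0 < a) : ∃ δ r₀ B > 0, ∀ m_T k m (1 ≤ k) (hL) (r ∈ [0, r₀]) (o_a ≥ 0) (c′ a′) (|c′|, |a′_μ| ≤ r)
(|a′_μ − ā_μ∘kingPrV| ≤ o_a): HasMaj (ofBlocks (unitTorusGeo L k M) (blkFine L k M)) (ofBlocks … (blockOf (L^m·L^k) M ∘ fst))
(𝔇_{kingPrV}(Δ′∘X′ − V₁′X̂′, Δ∘X̄ − V̄₁X̂̄)) (B((L^k)^{−1∕16} + r(L^k)^{−1∕(8(d+1))} + o_a)e^{−δd})`**, `M = MP (paramsOf d L m_T k hL)`, `X̂′ = bgPair Δ′_a⁻¹ (ρ′(sD′_μ)∘Δ′_a⁻¹)_μ c′ a′`,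
`X′ = pr₀X̂′`, `V₁′ = unstack c′ a′`, coarse partner at `(c̄, ā) = blockAvg`, `Δ = ρ(sLap)` — HYPOTHESIS-FREE; the SAME rate shape as K-J's entries 0–1 and D-E's entry 2.  Letters: K-J entry 0
at `(r, o_a)`; `V′ ≤ C₁e^{−δ₁d}` (part 47); `V′P − PV ≤ C₃(L^k)^{−1∕16}e^{−δ₃d}` (part 53 at `γ = ⅛`); `𝔇(a•Q′*Q′, a•Q*Q) ≤ 4ae^{ρ}(L^k)⁻¹e^{−(ρ∕2)d}` (N-IIs); `X̄ ≤ 2C₀e^{−(ρ∕2)d}` (II-B on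
the (1.110) rows, window `r ≤ (2C₀(d+2)c_r + 1)⁻¹`); common rate `ρ = min(δ₀, δ_E, δ₁, δ₃)`, letters at `ρ∕2`, output at `ρ∕4`.

HONEST FRAMING ∕ LIMITS.  Count-neutral assembly of LANDED rows; `U ≡ 1` Landau-gauge pair on the torus family of record; ABELIANISED scalar-multiplier model of (3.52)'s `V′(A)`,
block-averaged coarse partner (C3); «covariant Laplacian» := `Δ − V₁` of the model (Bałaban's `Δ_U` of (3.50) differs by the non-abelian dressing — n15-c's lane, located); letters on
`(c′, a′)` = sups + ONE fit of `a′`; rate exponents are currency artefacts; the four-entry packaging by name is the sequel Λ-C.  NE2⁺ NOT printed ∕ NOT proved; no statement of record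
touched; N15 NOT discharged; K3⁸ OPEN; counts UNMOVED (typed 28∕28 · discharged 6∕28 of record); one finite torus per index — NOT ℝ⁴ ∕ infinite volume ∕ OS ∕ mass gap ∕ Clay.  ONE declared
`set_option maxHeartbeats 800000 in` on ★★★ (five-letter assembly over long operator terms).
-/

noncomputable section

open scoped BigOperators
open Finset

namespace Summit.QuantumFields.YangMills.BalabanUVNodes.N15.TwoGrid

open Literature.MathematicalPhysics.QuantumFieldTheory.Balaban1983to89
open Literature.MathematicalPhysics.QuantumFieldTheory.Balaban1983to89.B11SectG (BlockNorm HasMaj)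
open Literature.MathematicalPhysics.QuantumFieldTheory.Balaban1983to89.T4EtaRateDefect (idef)
open Literature.MathematicalPhysics.QuantumFieldTheory.Balaban1983to89.T4EtaRateCoeffDefect (pull blockAvg)
open Literature.MathematicalPhysics.QuantumFieldTheory.Balaban1983to89.B5Prop11Plancherel (Tor fine)
open Literature.MathematicalPhysics.QuantumFieldTheory.Balaban1983to89.B5SiteBridgeP12 (MP)
open Literature.MathematicalPhysics.QuantumFieldTheory.King1986.Torus (blockOf tdistT tdistT_nonneg)
open Literature.MathematicalPhysics.QuantumFieldTheory.Balaban1983to89.B6UnitTorusCarrier (unitTorusGeo unitTorusGeo_dist_nonneg triangle254_unitTorusGeo rowSum_unitTorusGeo)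
open Summit.QuantumFields.YangMills.BalabanUVNodes.N15.VectorPiece (blkFine kingPrV)
open Summit.QuantumFields.YangMills.BalabanUVNodes.N15.BackgroundLayer (bgPair unstack projO abs_blockAvg_le)

variable (d : ℕ) {L : ℕ} [NeZero L]

/-! ## §31 ★★★ The dressed covariant-Laplacian entry of the pair of record, hypothesis-free -/

set_option maxHeartbeats 800000 in
/-- ★★★ **THE η-DEFECT OF THE DRESSED COVARIANT-LAPLACIAN ENTRY OF BAŁABAN's PAIR `(Δ′_a⁻¹, Δ_a⁻¹)`, SUP-BLOCK CURRENCY, HYPOTHESIS-FREE, NO LETTER ON `∇c′`, NO FIT OF `c′`.**  See the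
module docstring (WHAT).  Mechanism: Λ-A `(Δ − V₁)X = 1 + (V − a•Q*Q)X` differenced, `W′∘𝔇₀ + 𝔇(W′, W̄)∘X̄`; rows K-J (entry 0), part 47 (`V′`), part 53 (`V′P − PV`, `γ = ⅛`), N-IIs
(`a•Q*Q` on rough inputs), II-B (the coarse dressed value from the (1.110) rows); window `r₀ := min r₀^J (2C₀(d+2)c_r + 1)⁻¹`. [cite: Balaban1985BackgroundPropagators, Thm 3.1 (3.42) p.397
(fourth entry: the covariant Laplacian), (3.35) p.396, (3.52) p.400, (3.62)–(3.65) pp.402–403 (mechanism); Balaban1984PropagatorsI, (1.69)–(1.73) pp.29–30, (1.18) p.20, Prop. 1.2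
(1.110)–(1.111) p.35, (1.126) p.38; King1986, p.664 (pairing), Prop. 3.9 (3.73) p.665 (rate factor); Balaban1984PropagatorsII, Lemma 2.1 (2.61) p.234] -/
theorem hasMaj_idef_covLap_gOp (hLodd : Odd L) (hL3 : 3 ≤ L) {a : ℝ} (ha : 0 < a) :
    ∃ δ r₀ B : ℝ, 0 < δ ∧ 0 < r₀ ∧ 0 < B ∧ ∀ (mT k m : ℕ) (hk : 1 ≤ k) (hL : Odd L ∧ 1 < L) (r : ℝ) (_hr : 0 ≤ r) (_hr₀ : r ≤ r₀) (oa : ℝ) (_hoa : 0 ≤ oa)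
      (c' : Tor (fine (d := d + 1) (L ^ m * L ^ k) (MP (paramsOf d L mT k hL))) × Fin (d + 1) → ℝ)
      (a' : Fin (d + 1) → Tor (fine (d := d + 1) (L ^ m * L ^ k) (MP (paramsOf d L mT k hL))) × Fin (d + 1) → ℝ)
      (_hc' : ∀ z, |c' z| ≤ r) (_ha' : ∀ μ z, |a' μ z| ≤ r)
      (_hfa : ∀ μ z, |a' μ z - blockAvg (kingPrV L k m (MP (paramsOf d L mT k hL))) (a' μ) (kingPrV L k m (MP (paramsOf d L mT k hL)) z)| ≤ oa),
      HasMaj (BlockNorm.ofBlocks (unitTorusGeo L k (MP (paramsOf d L mT k hL))) (blkFine L k (MP (paramsOf d L mT k hL))))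
        (BlockNorm.ofBlocks (unitTorusGeo L k (MP (paramsOf d L mT k hL)))
          (fun i : Tor (fine (L ^ m * L ^ k) (MP (paramsOf d L mT k hL))) × Fin (d + 1) => blockOf (L ^ m * L ^ k) (MP (paramsOf d L mT k hL)) i.1))
        (idef (pull (kingPrV L k m (MP (paramsOf d L mT k hL)))) (pull (kingPrV L k m (MP (paramsOf d L mT k hL))))
          (symbOp (MP (paramsOf d L mT k hL)) (L ^ m * L ^ k) (sLap (MP (paramsOf d L mT k hL)) (L ^ m * L ^ k) ((L ^ m * L ^ k : ℕ) : ℝ)) ∘ₗ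
              (projO none ∘ₗ bgPair (gOp (MP (paramsOf d L mT k hL)) (L ^ m * L ^ k) a)
                (fun μ => symbOp (MP (paramsOf d L mT k hL)) (L ^ m * L ^ k) (sD (MP (paramsOf d L mT k hL)) (L ^ m * L ^ k) μ ((L ^ m * L ^ k : ℕ) : ℝ)) ∘ₗ
                  gOp (MP (paramsOf d L mT k hL)) (L ^ m * L ^ k) a) c' a')
            - unstack c' a' ∘ₗ bgPair (gOp (MP (paramsOf d L mT k hL)) (L ^ m * L ^ k) a)
                (fun μ => symbOp (MP (paramsOf d L mT k hL)) (L ^ m * L ^ k) (sD (MP (paramsOf d L mT k hL)) (L ^ m * L ^ k) μ ((L ^ m * L ^ k : ℕ) : ℝ)) ∘ₗ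
                  gOp (MP (paramsOf d L mT k hL)) (L ^ m * L ^ k) a) c' a')
          (symbOp (MP (paramsOf d L mT k hL)) (L ^ k) (sLap (MP (paramsOf d L mT k hL)) (L ^ k) ((L ^ k : ℕ) : ℝ)) ∘ₗ
              (projO none ∘ₗ bgPair (gOp (MP (paramsOf d L mT k hL)) (L ^ k) a)
                (fun μ => symbOp (MP (paramsOf d L mT k hL)) (L ^ k) (sD (MP (paramsOf d L mT k hL)) (L ^ k) μ ((L ^ k : ℕ) : ℝ)) ∘ₗ gOp (MP (paramsOf d L mT k hL)) (L ^ k) a)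
                (blockAvg (kingPrV L k m (MP (paramsOf d L mT k hL))) c') (fun μ => blockAvg (kingPrV L k m (MP (paramsOf d L mT k hL))) (a' μ)))
            - unstack (blockAvg (kingPrV L k m (MP (paramsOf d L mT k hL))) c') (fun μ => blockAvg (kingPrV L k m (MP (paramsOf d L mT k hL))) (a' μ)) ∘ₗ
                bgPair (gOp (MP (paramsOf d L mT k hL)) (L ^ k) a)
                  (fun μ => symbOp (MP (paramsOf d L mT k hL)) (L ^ k) (sD (MP (paramsOf d L mT k hL)) (L ^ k) μ ((L ^ k : ℕ) : ℝ)) ∘ₗ gOp (MP (paramsOf d L mT k hL)) (L ^ k) a)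
                  (blockAvg (kingPrV L k m (MP (paramsOf d L mT k hL))) c') (fun μ => blockAvg (kingPrV L k m (MP (paramsOf d L mT k hL))) (a' μ))))
        (fun y y' => B * (((L ^ k : ℕ) : ℝ) ^ (-(1 / 16 : ℝ)) + r * ((L ^ k : ℕ) : ℝ) ^ (-(1 / (8 * ((d : ℝ) + 1)))) + oa) *
          Real.exp (-(δ * tdistT (MP (paramsOf d L mT k hL)) y y'))) := by
  have hL2 : 2 ≤ L := by omega
  have hL : Odd L ∧ 1 < L := ⟨hLodd, by omega⟩
  -- the letters of record
  obtain ⟨δ₀, C₀, Cα, Cε, Cαε, hδ₀, hC₀, H110⟩ := ineq110_114_pair (d := d) hL ha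
  obtain ⟨δE, rE, BE, hδE, hrE, hBE, HE⟩ := hasMaj_projO_idef_bgPair_gOp d hLodd hL3 ha
  obtain ⟨δ₁, C₁, hδ₁, hC₁, HV⟩ := hasMaj_landauRe (d := d) (L := L)
  obtain ⟨δ₃, C₃, hδ₃, hC₃, HVd⟩ := hasMaj_landauDefect_family (d := d) hLodd hL2 ha (γ := 1 / 8) (by norm_num) (by norm_num)
  -- one rate
  obtain ⟨ρ, hρ⟩ : ∃ ρ : ℝ, ρ = min (min δ₀ δE) (min δ₁ δ₃) := ⟨_, rfl⟩
  have hρpos : 0 < ρ := hρ ▸ lt_min (lt_min hδ₀ hδE) (lt_min hδ₁ hδ₃)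
  have hρ0 : ρ ≤ δ₀ := hρ ▸ (min_le_left _ _).trans (min_le_left _ _)
  have hρE : ρ ≤ δE := hρ ▸ (min_le_left _ _).trans (min_le_right _ _)
  have hρ1 : ρ ≤ δ₁ := hρ ▸ (min_le_right _ _).trans (min_le_left _ _)
  have hρ3 : ρ ≤ δ₃ := hρ ▸ (min_le_right _ _).trans (min_le_right _ _)
  have hσ : 0 < ρ / 2 := by positivity
  have hσ4 : 0 < ρ / 2 / 2 := by positivity
  set cr : ℝ := B4Sect5Proof.latticeConst (d + 1) (ρ / 2) with hcr_def
  have hcr : 0 ≤ cr := B4Sect5Proof.latticeConst_nonneg (d + 1) hσ.le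
  set cq : ℝ := B4Sect5Proof.latticeConst (d + 1) (ρ / 2 / 2) with hcq_def
  have hcq : 0 ≤ cq := B4Sect5Proof.latticeConst_nonneg (d + 1) hσ4.le
  set ee : ℝ := Real.exp (ρ / 2) * Real.exp (ρ / 2) with hee_def
  have hee : 0 ≤ ee := by positivity
  -- the window and the constant
  set W : ℝ := C₀ * ((d : ℝ) + 2) * cr with hW_def
  have hW : 0 ≤ W := by positivity
  have hr₁ : 0 < (2 * W + 1)⁻¹ := by positivity
  set r₀ : ℝ := min rE (2 * W + 1)⁻¹ with hr₀_def
  have hr₀ : 0 < r₀ := lt_min hrE hr₁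
  obtain ⟨B, hB⟩ : ∃ B : ℝ, B = (C₁ * cq + a * ee) * BE + (C₃ + 4 * a * ee) * (2 * C₀) * cq + 1 := ⟨_, rfl⟩
  have hBpos : 0 < B := hB ▸ by positivity
  refine ⟨ρ / 2 / 2, r₀, B, hσ4, hr₀, hBpos, ?_⟩
  intro mT k m hk hL' r hr hrr₀ oa hoa c' a' hc' ha' hfa
  have hLr : (0 : ℝ) < (L : ℝ) := by exact_mod_cast (show 0 < L by omega)
  have hn : 1 ≤ L ^ k := Nat.one_le_pow _ _ (by omega)
  have hn' : 1 ≤ L ^ m * L ^ k := Nat.one_le_iff_ne_zero.mpr (NeZero.ne _)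
  have hkpos : (0 : ℝ) < ((L ^ k : ℕ) : ℝ) := by exact_mod_cast hn
  have hnr1 : (1 : ℝ) ≤ ((L ^ k : ℕ) : ℝ) := by exact_mod_cast hn
  have hrrE : r ≤ rE := hrr₀.trans (min_le_left _ _)
  have hrr₁ : r ≤ (2 * W + 1)⁻¹ := hrr₀.trans (min_le_right _ _)
  set θ : ℝ := ((L ^ k : ℕ) : ℝ) ^ (-(1 / 16 : ℝ)) with hθ_def
  have hθ : 0 ≤ θ := Real.rpow_nonneg hkpos.le _
  set θ' : ℝ := ((L ^ k : ℕ) : ℝ) ^ (-(1 / (8 * ((d : ℝ) + 1)))) with hθ'_def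
  have hθ' : 0 ≤ θ' := Real.rpow_nonneg hkpos.le _
  set T : ℝ := θ + r * θ' + oa with hT_def
  have hT : 0 ≤ T := by rw [hT_def]; exact add_nonneg (add_nonneg hθ (mul_nonneg hr hθ')) hoa
  have hθT : θ ≤ T := by rw [hT_def]; linarith [mul_nonneg hr hθ']
  have hinv : (((L ^ k : ℕ) : ℝ))⁻¹ ≤ θ := by
    rw [hθ_def, ← Real.rpow_neg_one]
    exact Real.rpow_le_rpow_of_exponent_le hnr1 (by norm_num)
  have hweak : ∀ {F₁ F₂ : Type} [AddCommGroup F₁] [Module ℝ F₁] [AddCommGroup F₂] [Module ℝ F₂]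
      {b₁ : BlockNorm (unitTorusGeo L k (MP (paramsOf d L mT k hL'))) F₁} {b₂ : BlockNorm (unitTorusGeo L k (MP (paramsOf d L mT k hL'))) F₂} {Top : F₁ →ₗ[ℝ] F₂} {A tt : ℝ},
      0 ≤ A → ρ ≤ tt → HasMaj b₁ b₂ Top (fun y y' => A * Real.exp (-(tt * tdistT (MP (paramsOf d L mT k hL')) y y'))) →
      HasMaj b₁ b₂ Top (fun y y' => A * Real.exp (-(ρ / 2 * tdistT (MP (paramsOf d L mT k hL')) y y'))) :=
    fun hA htt h => h.mono fun y y' => mul_le_mul_of_nonneg_left (Real.exp_le_exp.mpr (by nlinarith [tdistT_nonneg (MP (paramsOf d L mT k hL')) y y'])) hA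
  -- (i) entry 0 of the dressed jet
  have h₀ := hweak (A := BE * T) (mul_nonneg hBE.le hT) hρE (HE mT k m hk hL' r hr hrrE oa hoa c' a' hc' ha' hfa none)
  -- (ii) `V′`, (iii) the Landau two-grid defect at `γ = ⅛`
  have h₁ := hweak hC₁.le hρ1 (HV k (L ^ m * L ^ k) (MP (paramsOf d L mT k hL')))
  have hγ8 : (-((1 / 8 : ℝ) / 2)) = -(1 / 16 : ℝ) := by norm_num
  have h₂' := HVd mT k m hk hL'
  rw [hγ8] at h₂'
  have h₂ := hweak (A := C₃ * θ) (mul_nonneg hC₃.le hθ) hρ3 h₂'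
  -- (iv) the averaging letter on rough inputs at rate `ρ∕2`
  have h₃' := hasMaj_idef_qvAdjRe_qvRe_rough (L := L) (MP (paramsOf d L mT k hL')) k m a hσ.le
  have hA3eq : |a| * (4 * Real.exp (ρ / 2) * Real.exp (ρ / 2) / ((L ^ k : ℕ) : ℝ)) = 4 * a * ee * (((L ^ k : ℕ) : ℝ))⁻¹ := by
    rw [abs_of_pos ha, hee_def, div_eq_mul_inv]; ring
  have hA3 : 0 ≤ 4 * a * ee * (((L ^ k : ℕ) : ℝ))⁻¹ := mul_nonneg (mul_nonneg (mul_nonneg (by norm_num) ha.le) hee) (inv_nonneg.mpr hkpos.le)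
  have h₃ : HasMaj (BlockNorm.ofBlocks (unitTorusGeo L k (MP (paramsOf d L mT k hL'))) (blkFine L k (MP (paramsOf d L mT k hL'))))
      (BlockNorm.ofBlocks (unitTorusGeo L k (MP (paramsOf d L mT k hL'))) (fun i : Tor (fine (L ^ m * L ^ k) (MP (paramsOf d L mT k hL'))) × Fin (d + 1) => blockOf (L ^ m * L ^ k) (MP (paramsOf d L mT k hL')) i.1))
      (idef (pull (kingPrV L k m (MP (paramsOf d L mT k hL')))) (pull (kingPrV L k m (MP (paramsOf d L mT k hL'))))
        (a • (qvAdjRe (MP (paramsOf d L mT k hL')) (L ^ m * L ^ k) ∘ₗ qvRe (MP (paramsOf d L mT k hL')) (L ^ m * L ^ k)))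
        (a • (qvAdjRe (MP (paramsOf d L mT k hL')) (L ^ k) ∘ₗ qvRe (MP (paramsOf d L mT k hL')) (L ^ k))))
      (fun y y' => 4 * a * ee * (((L ^ k : ℕ) : ℝ))⁻¹ * Real.exp (-(ρ / 2 * tdistT (MP (paramsOf d L mT k hL')) y y'))) :=
    h₃'.mono fun y y' => by rw [hA3eq]; exact le_of_eq rfl
  -- (v) the (1.110) rows of both members, the fine fixed point, the coarse dressed value
  obtain ⟨Hc, Hf⟩ := H110 mT k m hk
  have hG := hasMaj_gOp_of_ineq (L := L) (MP (paramsOf d L mT k hL')) k (L ^ k) a hn Hc hC₀.le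
  have hGD := fun μ : Fin (d + 1) => hasMaj_grad_of_ineq (L := L) (MP (paramsOf d L mT k hL')) k (L ^ k) a hn Hc hC₀.le μ
  have hG' := hasMaj_gOp_of_ineq (L := L) (MP (paramsOf d L mT k hL')) k (L ^ m * L ^ k) a hn' Hf hC₀.le
  have hG'D := fun μ : Fin (d + 1) => hasMaj_grad_of_ineq (L := L) (MP (paramsOf d L mT k hL')) k (L ^ m * L ^ k) a hn' Hf hC₀.le μ
  have hcb : ∀ x, |blockAvg (kingPrV L k m (MP (paramsOf d L mT k hL'))) c' x| ≤ r := fun x => abs_blockAvg_le _ hr hc' x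
  have hab : ∀ μ x, |blockAvg (kingPrV L k m (MP (paramsOf d L mT k hL'))) (a' μ) x| ≤ r := fun μ x => abs_blockAvg_le _ hr (ha' μ) x
  have hcard : r * (1 + Fintype.card (Fin (d + 1))) ≤ r * ((d : ℝ) + 2) := by rw [Fintype.card_fin]; push_cast; exact le_of_eq (by ring)
  have h1 : (2 * W + 1)⁻¹ * (2 * W + 1) = 1 := inv_mul_cancel₀ (by positivity)
  have hqle : C₀ * (r * ((d : ℝ) + 2)) * cr ≤ 1 / 2 := by
    calc C₀ * (r * ((d : ℝ) + 2)) * cr = r * W := by rw [hW_def]; ring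
      _ ≤ (2 * W + 1)⁻¹ * W := mul_le_mul_of_nonneg_right hrr₁ hW
      _ ≤ 1 / 2 := by nlinarith [h1, hr₁.le]
  have hq : C₀ * (r * ((d : ℝ) + 2)) * cr < 1 := by linarith
  have hq2 : (1 - C₀ * (r * ((d : ℝ) + 2)) * cr)⁻¹ ≤ 2 := by
    calc (1 - C₀ * (r * ((d : ℝ) + 2)) * cr)⁻¹ ≤ (1 / 2)⁻¹ := inv_anti₀ (by norm_num) (by linarith)
      _ = 2 := by norm_num
  have hq0 : 0 ≤ (1 - C₀ * (r * ((d : ℝ) + 2)) * cr)⁻¹ := inv_nonneg.mpr (by linarith)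
  have hρδ₀ : ρ / 2 + ρ / 2 ≤ δ₀ := by linarith
  obtain ⟨hunit, hX⟩ := hasMaj_bgPair_comp (blkFine L k (MP (paramsOf d L mT k hL'))) (triangle254_unitTorusGeo L k (MP (paramsOf d L mT k hL')))
    (unitTorusGeo_dist_nonneg L k (MP (paramsOf d L mT k hL'))) (rowSum_unitTorusGeo L k (MP (paramsOf d L mT k hL')) hσ) hσ.le hσ.le hρδ₀ hC₀.le hr hG hGD hcb hab hcard hq none
  have hunit' := (hasMaj_bgPair_comp _ (triangle254_unitTorusGeo L k (MP (paramsOf d L mT k hL'))) (unitTorusGeo_dist_nonneg L k (MP (paramsOf d L mT k hL')))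
    (rowSum_unitTorusGeo L k (MP (paramsOf d L mT k hL')) hσ) hσ.le hσ.le hρδ₀ hC₀.le hr hG' hG'D hc' ha' hcard hq none).1
  have h₄ : HasMaj (BlockNorm.ofBlocks (unitTorusGeo L k (MP (paramsOf d L mT k hL'))) (blkFine L k (MP (paramsOf d L mT k hL'))))
      (BlockNorm.ofBlocks (unitTorusGeo L k (MP (paramsOf d L mT k hL'))) (blkFine L k (MP (paramsOf d L mT k hL'))))
      (projO none ∘ₗ bgPair (gOp (MP (paramsOf d L mT k hL')) (L ^ k) a)
        (fun μ => symbOp (MP (paramsOf d L mT k hL')) (L ^ k) (sD (MP (paramsOf d L mT k hL')) (L ^ k) μ ((L ^ k : ℕ) : ℝ)) ∘ₗ gOp (MP (paramsOf d L mT k hL')) (L ^ k) a)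
        (blockAvg (kingPrV L k m (MP (paramsOf d L mT k hL'))) c') (fun μ => blockAvg (kingPrV L k m (MP (paramsOf d L mT k hL'))) (a' μ)))
      (fun y y' => 2 * C₀ * Real.exp (-(ρ / 2 * tdistT (MP (paramsOf d L mT k hL')) y y'))) :=
    hX.mono fun y y' => mul_le_mul_of_nonneg_right (by linarith [mul_le_mul_of_nonneg_left hq2 hC₀.le]) (Real.exp_nonneg _)
  -- Λ-A's five-letter assembly at rate `ρ∕2`
  have key := hasMaj_idef_covLap_of_letters (MP (paramsOf d L mT k hL')) k m a ha hunit hunit' hσ (mul_nonneg hBE.le hT) hC₁.le (mul_nonneg hC₃.le hθ) hA3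
    (by positivity) h₀ h₁ h₂ h₃ h₄
  refine key.mono fun y y' => mul_le_mul_of_nonneg_right ?_ (Real.exp_nonneg _)
  -- the constant: `((C₁·BE·T + (C₃θ + 4aee(L^k)⁻¹)·2C₀)·c_q + a·BE·T·ee) ≤ B·T`
  have hrow3 : C₃ * θ + 4 * a * ee * (((L ^ k : ℕ) : ℝ))⁻¹ ≤ (C₃ + 4 * a * ee) * T := by
    have h4 : 4 * a * ee * (((L ^ k : ℕ) : ℝ))⁻¹ ≤ 4 * a * ee * T := mul_le_mul_of_nonneg_left (hinv.trans hθT) (mul_nonneg (mul_nonneg (by norm_num) ha.le) hee)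
    have h5 : C₃ * θ ≤ C₃ * T := mul_le_mul_of_nonneg_left hθT hC₃.le
    linarith
  have hmid : (C₃ * θ + 4 * a * ee * (((L ^ k : ℕ) : ℝ))⁻¹) * (2 * C₀) ≤ (C₃ + 4 * a * ee) * T * (2 * C₀) := mul_le_mul_of_nonneg_right hrow3 (by positivity)
  rw [abs_of_pos ha]
  calc (C₁ * (BE * T) + (C₃ * θ + 4 * a * ee * (((L ^ k : ℕ) : ℝ))⁻¹) * (2 * C₀)) * cq + a * (BE * T) * Real.exp (ρ / 2) * Real.exp (ρ / 2)
      = (C₁ * cq + a * ee) * BE * T + (C₃ * θ + 4 * a * ee * (((L ^ k : ℕ) : ℝ))⁻¹) * (2 * C₀) * cq := by rw [hee_def]; ring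
    _ ≤ (C₁ * cq + a * ee) * BE * T + (C₃ + 4 * a * ee) * T * (2 * C₀) * cq := add_le_add le_rfl (mul_le_mul_of_nonneg_right hmid hcq)
    _ = (B - 1) * T := by rw [hB]; ring
    _ ≤ B * T := by nlinarith [hT]

end Summit.QuantumFields.YangMills.BalabanUVNodes.N15.TwoGrid

end
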